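import Literature.NumberTheory.LFunctions.ClassGroupLogFreeLemmaA
import Literature.NumberTheory.LFunctions.DedekindZetaPartialFraction
import Literature.NumberTheory.LFunctions.DedekindZetaClassicalRegionBounds
import HarnessLib

/-!
# Bombieri's Lemme A for `ζ₁_K(s) = (s − 1) ζ_K(s)`, uniformly in the number field

Topic `Literature/NumberTheory/LFunctions`, namespace `Literature.NumberTheory.LFunctions.NumberField`.
Everything here is PROVED (theorems only; no named facts).

The `χ = 1` member of the family of `ClassGroupLogFreeLemmaA`: the entire `ζ₁_K = dedekindZeta₁ K`
(`ζ₁_K(1) = κ_K ≠ 0`, no zeros on `Re s ≥ 1`, tree `dedekindZeta₁_ne_zero_of_one_le_re`), with the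
tree's local data (`norm_logDeriv_dedekindZeta₁_sub_sum_le`, `sum_divisor_dedekindZeta₁_bigDisc_le`,
`logDeriv_dedekindZeta₁_eq`, `re_LSeries_vonMangoldtNorm_le`) fed into the abstract local lemmas of
`LogFreeLocalAbstract` and the tree's `LogFreeDensity.lemmeA_abstract`, with the same height
`ℒ' = lemmaAHeight K v`:

* `norm_logDeriv_dedekindZeta₁_le` — `|ζ₁_K'/ζ₁_K(s)| ≤ 2/(σ − 1) + 77760 · discBound` (`1 < σ ≤ 2`);
* `localCount_dedekindZeta₁_le` — Lemme de densité `≤ 8(1 + λℒ')`;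
* `lemmeA_dedekindZeta₁` — **Lemme A for `ζ₁_K`** (absolute `c₄`; the conclusion is about
  `(ζ₁_K'/ζ₁_K)^{(k)}(1 + r + iv)`, whose series side carries the pole term `(−1)^k k!/(s₀ − 1)^{k+1}`).

## References

* [Bombieri1987GrandCrible] E. Bombieri, Astérisque 18 (1987), §6 Lemme A (the case of `ζ`).
* [ThornerZaman2017] J. Thorner, A. Zaman, Algebra Number Theory 11 (2017), §5 (Lemma 5.4, `δ(χ) = 1`).
-/

noncomputable section

open Complex Metric Set Filter Finset
open scoped Real Topology

namespace Literature.NumberTheory.LFunctions.NumberField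

open Literature.NumberTheory.LFunctions.LogFreeLocal Literature.NumberTheory.LFunctions.LogFreeDensity
open scoped nonZeroDivisors _root_.NumberField

variable {K : Type*} [Field K] [NumberField K]

/-- `ζ₁_K(2 + iv) ≠ 0`. [folklore] -/
theorem dedekindZeta₁_two_add_ne_zero (v : ℝ) : dedekindZeta₁ K (2 + (v : ℂ) * I) ≠ 0 :=
  dedekindZeta₁_ne_zero_of_one_le_re (by simp)

/-- **`|ζ₁_K'/ζ₁_K(s)| ≤ 2/(σ − 1) + 77760 · discBound K t`** for `1 < σ ≤ 2`
(`ζ₁'/ζ₁ = 1/(s−1) − L(Λ_K, s)`, `|L(Λ_K, s)| ≤ L(Λ_K, σ) ≤ 1/(σ−1) + 77760 M_K`). [folklore] -/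
theorem norm_logDeriv_dedekindZeta₁_le {s : ℂ} (hs : 1 < s.re) (hs2 : s.re ≤ 2) :
    ‖logDeriv (dedekindZeta₁ K) s‖ ≤ 2 / (s.re - 1) + 77760 * discBound K s.im := by
  rw [logDeriv_dedekindZeta₁_eq hs]
  have h1 : ‖(1 : ℂ) / (s - 1)‖ ≤ 1 / (s.re - 1) := by
    rw [norm_div, norm_one]
    refine div_le_div_of_nonneg_left zero_le_one (by linarith) ?_
    have := Complex.abs_re_le_norm (s - 1)
    simp at this
    rw [abs_of_pos (by linarith)] at this
    exact this
  have h2 : ‖LSeries (fun n ↦ (vonMangoldtNorm K n : ℂ)) s‖ ≤ 1 / (s.re - 1) + 77760 * discBound K s.im := by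
    have hb := Literature.NumberTheory.LFunctions.TwistedZFR.norm_LSeries_le_of_norm_le
      (Λ₀ := vonMangoldtNorm K) (f := fun n ↦ (vonMangoldtNorm K n : ℂ))
      (fun n ↦ by rw [Complex.norm_real, Real.norm_of_nonneg (vonMangoldtNorm_nonneg n)])
      (fun s hs ↦ LSeriesSummable_vonMangoldtNorm hs) hs le_rfl
    refine hb.trans ?_
    have h := re_LSeries_vonMangoldtNorm_le (K := K) (s := (s.re : ℂ)) (by simpa using hs) (by simpa using hs2)
    have hre : ((1 : ℂ) / ((s.re : ℂ) - 1)).re = 1 / (s.re - 1) := by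
      rw [show ((s.re : ℂ) - 1) = ((s.re - 1 : ℝ) : ℂ) by push_cast; ring, ← Complex.ofReal_one, ← Complex.ofReal_div,
        Complex.ofReal_re]
    rw [hre, Complex.ofReal_im] at h
    -- `discBound K 0 ≤ discBound K s.im`
    have hmono : discBound K 0 ≤ discBound K s.im := by
      rw [discBound, discBound]
      have : Real.log (|(0:ℝ)| + 7) ≤ Real.log (|s.im| + 7) :=
        Real.log_le_log (by norm_num) (by simp [abs_nonneg])
      have hn : (0 : ℝ) ≤ Module.finrank ℚ K := Nat.cast_nonneg _
      nlinarith
    linarith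
  calc ‖1 / (s - 1) - LSeries (fun n ↦ (vonMangoldtNorm K n : ℂ)) s‖
      ≤ ‖(1 : ℂ) / (s - 1)‖ + ‖LSeries (fun n ↦ (vonMangoldtNorm K n : ℂ)) s‖ := norm_sub_le _ _
    _ ≤ 1 / (s.re - 1) + (1 / (s.re - 1) + 77760 * discBound K s.im) := add_le_add h1 h2
    _ = _ := by ring

/-- **Lemme de densité for `ζ₁_K`**: for `0 < λ ≤ 1/4`,
`Σ_{|ρ−(1+iv)| ≤ λ} m(ρ) ≤ 8(1 + λℒ')`. [cite: Bombieri1987GrandCrible, §6 Lemme de densité] -/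
theorem localCount_dedekindZeta₁_le (v : ℝ) {lam : ℝ} (hlam : 0 < lam) (hlam4 : lam ≤ 1 / 4) :
    ∑ ρ ∈ (discZeros (dedekindZeta₁ K) v).filter (fun ρ => ‖ρ - (1 + (v : ℂ) * I)‖ ≤ lam),
        (discDivisor (dedekindZeta₁ K) v ρ : ℝ) ≤ 8 * (1 + lam * lemmaAHeight K v) := by
  set f := dedekindZeta₁ K with hf
  set s : ℂ := ((1 + lam : ℝ) : ℂ) + (v : ℂ) * I with hs
  have hsre : s.re = 1 + lam := by simp [hs]
  have hsim : s.im = v := by simp [hs]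
  have hs1 : 1 < s.re := by rw [hsre]; linarith
  have hs2 : s.re ≤ 2 := by rw [hsre]; linarith
  have hsmem : s ∈ closedBall (2 + (v : ℂ) * I) (7 / 4) := by
    rw [mem_closedBall, dist_eq_norm]
    have : s - (2 + (v : ℂ) * I) = ((lam - 1 : ℝ) : ℂ) := by rw [hs]; push_cast; ring
    rw [this, Complex.norm_real, Real.norm_eq_abs, abs_of_nonpos (by linarith)]; linarith
  have hfs : f s ≠ 0 := dedekindZeta₁_ne_zero_of_one_le_re hs1.le
  have hpf := norm_logDeriv_dedekindZeta₁_sub_sum_le (K := K) v hsmem hfs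
  have hld := norm_logDeriv_dedekindZeta₁_le (K := K) hs1 hs2
  rw [hsre, hsim, show (1 : ℝ) + lam - 1 = lam by ring] at hld
  have hld' : ‖logDeriv f s‖ ≤ 1 / lam + (1 / lam + 77760 * discBound K v) := by
    rw [hf]; have : (2 : ℝ) / lam = 1 / lam + 1 / lam := by ring
    linarith
  have hre : ∀ ρ ∈ discZeros f v, ρ.re ≤ 1 := by
    intro ρ hρ
    have h0 := ((mem_discZeros (differentiable_dedekindZeta₁ K) (dedekindZeta₁_two_add_ne_zero v)).1 hρ).2
    by_contra hgt
    rw [not_le] at hgt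
    exact dedekindZeta₁_ne_zero_of_one_le_re hgt.le h0
  have h := sum_near_le (differentiable_dedekindZeta₁ K) hlam hre hpf hld'
  refine h.trans ?_
  have hℒ := discBound_le_lemmaAHeight (K := K) v
  have hℒ0 : 0 ≤ discBound K v := le_trans zero_le_one (one_le_discBound K v)
  have hn : (0 : ℝ) ≤ Module.finrank ℚ K := Nat.cast_nonneg _
  -- `77760·discBound ≤ lemmaAHeight`
  have key : 2 * (77760 * discBound K v) ≤ lemmaAHeight K v := by
    rw [lemmaAHeight]; nlinarith
  have h1 : 4 * lam * (1 / lam + 77760 * discBound K v) = 4 + 4 * lam * (77760 * discBound K v) := by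
    field_simp
  rw [h1]
  nlinarith [mul_nonneg hlam.le hℒ0]

/-- **Bombieri's Lemme A for `ζ₁_K`**, uniformly in the number field: there is an absolute `c₄ > 0`
such that for every number field `K`, all real `v`, `L' ≥ ℒ'_v`, `0 < r` with `512 r ≤ 1/8`, `rL' ≥ 1`:
if `ζ_K` has a zero `ρ₀` with `|ρ₀ − (1 + iv)| ≤ r`, then for every natural `K' ≥ c₄ rL' + 2` there is
`k ∈ [K', 2K']` with `e^{−10K'} (2r)^{−(k+1)} ≤ ‖(ζ₁_K'/ζ₁_K)^{(k)}(1 + r + iv)‖/k!`.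
[cite: Bombieri1987GrandCrible, §6 Lemme A] -/
theorem lemmeA_dedekindZeta₁ :
    ∃ c₄ : ℝ, 0 < c₄ ∧ ∀ (K : Type*) [Field K] [NumberField K],
      ∀ (v r L' : ℝ), lemmaAHeight K v ≤ L' → 0 < r → 512 * r ≤ 1 / 8 → 1 ≤ r * L' →
        (∃ ρ₀ : ℂ, dedekindZeta₁ K ρ₀ = 0 ∧ ‖ρ₀ - (1 + (v : ℂ) * I)‖ ≤ r) →
        ∀ K' : ℕ, c₄ * (r * L') + 2 ≤ K' →
          ∃ k ∈ Finset.Icc K' (2 * K'),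
            Real.exp (-(10 * K')) * (2 * r)⁻¹ ^ (k + 1) ≤
              ‖iteratedDeriv k (logDeriv (dedekindZeta₁ K)) (((1 + r : ℝ) : ℂ) + (v : ℂ) * I)‖ / k.factorial := by
  obtain ⟨c₄, hc₄, h⟩ := lemmeA_abstract (C_d := 8) (C_J := 1) (C₁ := 1) (by norm_num) one_pos one_pos
  refine ⟨c₄, hc₄, fun K _ _ v r L' hL hr hr8 hu hzero K' hK' ↦ ?_⟩
  set f := dedekindZeta₁ K with hf
  have hdf : Differentiable ℂ f := differentiable_dedekindZeta₁ K
  have hfc : f (2 + (v : ℂ) * I) ≠ 0 := dedekindZeta₁_two_add_ne_zero v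
  set s₀ : ℂ := ((1 + r : ℝ) : ℂ) + (v : ℂ) * I with hs₀
  have hr0 : r ≤ 1 / 4096 := by linarith
  have hs₀re : s₀.re = 1 + r := by simp [hs₀]
  have hs₀1 : 1 < s₀.re := by rw [hs₀re]; linarith
  have hfs₀ : f s₀ ≠ 0 := dedekindZeta₁_ne_zero_of_one_le_re hs₀1.le
  have hs₀mem : s₀ ∈ closedBall (2 + (v : ℂ) * I) (3 / 2) := by
    rw [mem_closedBall, dist_eq_norm]
    have : s₀ - (2 + (v : ℂ) * I) = ((r - 1 : ℝ) : ℂ) := by rw [hs₀]; push_cast; ring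
    rw [this, Complex.norm_real, Real.norm_eq_abs, abs_of_nonpos (by linarith)]; linarith
  have hℒ1 := one_le_lemmaAHeight (K := K) v
  have hℒd := discBound_le_lemmaAHeight (K := K) v
  have hL'0 : 0 ≤ L' := le_trans (le_trans zero_le_one hℒ1) hL
  refine h (discZeros f v) (discDivisor f v) (fun k ↦ iteratedDeriv k (logDeriv f) s₀) v r L'
    hr hr8 hu (fun ρ ↦ discDivisor_nonneg hdf v ρ) ?_ ?_ ?_ ?_ ?_ K' hK'
  · intro ρ hρ
    have hmem := (mem_discZeros hdf hfc).1 hρ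
    refine ⟨?_, by exact_mod_cast one_le_discDivisor hdf hfc hρ⟩
    by_contra hge
    rw [not_lt] at hge
    exact dedekindZeta₁_ne_zero_of_one_le_re hge hmem.2
  · intro lam hlam hlam4
    refine (localCount_dedekindZeta₁_le (K := K) v hlam hlam4).trans ?_
    have := mul_le_mul_of_nonneg_left hL hlam.le
    nlinarith
  · -- Jensen: `32 · discBound ≤ L'`
    have hJ : ∑ ρ ∈ discZeros f v, (discDivisor f v ρ : ℝ) ≤ 32 * discBound K v :=
      sum_divisor_dedekindZeta₁_bigDisc_le (K := K) v
    refine hJ.trans ?_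
    rw [one_mul]
    refine le_trans ?_ hL
    rw [lemmaAHeight]
    have hℒ0 : 0 ≤ discBound K v := le_trans zero_le_one (one_le_discBound K v)
    have hn : (0 : ℝ) ≤ Module.finrank ℚ K := Nat.cast_nonneg _
    nlinarith
  · intro k
    have hpf : ∀ z ∈ closedBall (2 + (v : ℂ) * I) (7 / 4), f z ≠ 0 →
        ‖logDeriv f z - ∑ ρ ∈ discZeros f v, (discDivisor f v ρ : ℂ) / (z - ρ)‖ ≤ 77760 * discBound K v :=
      fun z hz hfz ↦ norm_logDeriv_dedekindZeta₁_sub_sum_le (K := K) v hz hfz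
    have hE : (0 : ℝ) ≤ 77760 * discBound K v := by
      have := one_le_discBound K v; positivity
    have hC := norm_iteratedDeriv_logDeriv_sub_le hdf hfc hE hpf hs₀mem hfs₀ k
    refine hC.trans ?_
    have hfac : (0 : ℝ) ≤ k.factorial * 16 ^ k := by positivity
    calc (k.factorial : ℝ) * 16 ^ k * (77760 * discBound K v) ≤ k.factorial * 16 ^ k * (1 * L') := by
          refine mul_le_mul_of_nonneg_left ?_ hfac
          rw [one_mul]
          refine le_trans ?_ hL
          rw [lemmaAHeight]
          have hℒ0 : 0 ≤ discBound K v := le_trans zero_le_one (one_le_discBound K v)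
          have hn : (0 : ℝ) ≤ Module.finrank ℚ K := Nat.cast_nonneg _
          nlinarith
      _ = _ := by ring
  · obtain ⟨ρ₀, hρ₀, hρ₀r⟩ := hzero
    refine ⟨ρ₀, (mem_discZeros hdf hfc).2 ⟨?_, hρ₀⟩, hρ₀r⟩
    rw [mem_closedBall, dist_eq_norm]
    calc ‖ρ₀ - (2 + (v : ℂ) * I)‖ = ‖(ρ₀ - (1 + (v : ℂ) * I)) + (-1 : ℂ)‖ := by ring_nf
      _ ≤ ‖ρ₀ - (1 + (v : ℂ) * I)‖ + ‖(-1 : ℂ)‖ := norm_add_le _ _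
      _ ≤ r + 1 := by rw [norm_neg, norm_one]; linarith
      _ ≤ 31 / 16 := by linarith

end Literature.NumberTheory.LFunctions.NumberField

end
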